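import Summits.AtomisticToContinuum.HydrodynamicLimit.Theorems.InformationPercolationEngineChaosClosesEulerEntropyBalanceG
import Literature.Analysis.FluidPDE.BoltzmannEquation
import HarnessLib

/-!
# Windowed entropy balance (WEB) — the entropic twin of windowed collision invariance

Helper for the line `empirical-h-theorem` (crux-strategist s2; adopted by the lead after the line `Sketch` completed) of the crux
`InformationPercolationEngine.ChaosClosesEuler` (stmt-AtomisticToContinuum-15141), skeleton
`Cruxes/ChaosClosesEuler/Lines/empirical_h_theorem.lean`, registered stub `stub_windowedEntropyBalance`: body VERBATIM the skeleton def `WindowedEntropyBalance`: along every good orbit and every window the tent×cone windowed, normalised collision functional of the entropic mark `Λ̃_x(vᵢ⁻) − Λ̃_x(vᵢ⁺)` is `≤ ε·C₁(1+E/(N+1))³ + C₂·Q⁴/(N+1)` (deterministic: exact first-order jump identity of the bounded coarse-grained entropy functional, Abel summation against the tent).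

PROOF (helpers `…EntropyBalanceA`–`F`). With `𝒮(w) = ∫ₓ b_r(x,x₀) h(ρ_r(x)) S_w(x) dx` the windowed coarse-grained
entropy functional (`FS`): (1) at a collision time `s` exactly one pair `{p,q}` is in contact and the recorded
pre-collisional velocities are the left limits, so the ordered-pair sum of the entropic marks is the particle sum
`Σₖ ∫ₓ b h b_k (Λ̃(vₖ⁻) − Λ̃(vₖ⁺))` (`pairSum_eq_particleSum'`), which is `(N+1)(𝒮(γ(s⁻)) − 𝒮(γ(s)))` up to
`(3/(πr³)) C_h C_R⁰ (1+|v_p|⁴+|v_q|⁴)/(N+1)` (helper E, exact first-order jump of the entropy density) and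
`1 + |v_p|⁴ + |v_q|⁴` is half the quartic pair sum at `s`; (2) along the increasing enumeration of the collision
times of `[0, τ]` the functional is bounded by `C_B(1+E/(N+1))` (helper C, energy conservation) and drifts by at most
`C_L(1+E/(N+1))² Δt` between consecutive collisions (helper F, free flight), the tent is `r⁻¹`-bounded and
`r⁻²`-Lipschitz, so Abel summation with drift (`abel_drift_bound`) bounds `Σ_s bt(s−t₀)(𝒮(γ(s⁻)) − 𝒮(γ(s)))` by
`(2C_B/r + C_Bτ/r² + C_Lτ/r)(1+E/(N+1))²`; (3) multiply by `ε`, collect the remainders into `C₂ Q⁴/(N+1)`.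

References: L. Boltzmann (1872); folklore (coarse-grained H-functional); template: the landed `ChaosClosesEulerCollisionInvariance` (p98069).
-/

noncomputable section

namespace Summit.AtomisticToContinuum.HydrodynamicLimit.Theorems.ChaosClosesEulerEntropyBalance

open scoped BigOperators Topology Classical MeasureTheory ENNReal InnerProductSpace
open Filter Set MeasureTheory
open Literature.MathematicalPhysics.KineticTheory
open Literature.Analysis.FluidPDE
open Summit.AtomisticToContinuum.HydrodynamicLimit.Theses
open Summit.AtomisticToContinuum.HydrodynamicLimit.Theses.InformationPercolationEngine
open Summit.AtomisticToContinuum.HydrodynamicLimit.Theorems.LocalSecondLawNegative (cone rhoC cone_nonneg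
  continuous_cone rhoC_nonneg continuous_rhoC)
open Summit.AtomisticToContinuum.HydrodynamicLimit.Theorems.ChaosClosesEulerWindowedInvariance (cone_nonneg_le
  tent_nonneg_le abs_tent_sub_tent_le)

/-! ## §1 The bound along one orbit and the registered stub -/

/-- **Step 3 — the windowed entropy balance along one hard-sphere trajectory on `𝕋³`** (diameter
`ε ∈ (0, 1/2)`, started at `z`), with the explicit constants `C₁`, `C₂`. [folklore] -/
theorem web_traj {τ r δ : ℝ} (hτ : 0 < τ) (hr : 0 < r) (hδ : 0 < δ) (K : ℝ) {h : ℝ → ℝ} {Ch Lh : ℝ}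
    (hLh : 0 ≤ Lh) (hhb : ∀ a, |h a| ≤ Ch) (hhL : ∀ a b, |h a - h b| ≤ Lh * |a - b|) (x₀ : T3) (t₀ : ℝ)
    {N : ℕ} {ε : ℝ} (hε : 0 < ε) (hG : (Torus.geometry (Fin 3)).IsHardSphereRegular ε)
    {γ : ℝ → Config (N + 1) (Fin 3) T3} (hγ : IsHardSphereTrajectory (Torus.geometry (Fin 3)) ε (N + 1) γ)
    {z : Config (N + 1) (Fin 3) T3} (h0 : γ 0 = z) :
    |ε / (N + 1 : ℝ) * ∑ᶠ (s : ℝ) (_ : s ∈ collisionTimes (Torus.geometry (Fin 3)) ε γ ∩ Set.Icc 0 τ),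
        ∑ i : Fin (N + 1), ∑ j : Fin (N + 1),
          (if i ≠ j ∧ ‖(Torus.geometry (Fin 3)).sepVec (γ s i).1 (γ s j).1‖ = ε then
            r⁻¹ * max (1 - |s - t₀| / r) 0 * ∫ x, cone r x x₀ * h (rhoC r (γ s) x) * cone r (γ s i).1 x *
              (LamC r δ K (γ s) x (reflectVel ((Torus.geometry (Fin 3)).sepVec (γ s i).1 (γ s j).1)
                ((γ s i).2, (γ s j).2)).1 - LamC r δ K (γ s) x (γ s i).2) else 0)|
      ≤ ε * C1 r δ K Ch Lh τ * (1 + configEnergy z / (N + 1 : ℝ)) ^ 3 +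
        C2 r δ K Ch * (ε / (N + 1 : ℝ) * ∑ᶠ (s : ℝ) (_ : s ∈ collisionTimes (Torus.geometry (Fin 3)) ε γ ∩ Set.Icc 0 τ),
          ∑ i : Fin (N + 1), ∑ j : Fin (N + 1),
            (if i ≠ j ∧ ‖(Torus.geometry (Fin 3)).sepVec (γ s i).1 (γ s j).1‖ = ε then
              1 + ‖(γ s i).2‖ ^ 4 + ‖(γ s j).2‖ ^ 4 else 0)) / (N + 1 : ℝ) := by
  set G : Geometry (Fin 3) T3 := Torus.geometry (Fin 3) with hG_def
  have hcont : Continuous h := continuous_of_lip hhL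
  have hN : (0 : ℝ) < N + 1 := by positivity
  set e := configEnergy z / (N + 1 : ℝ) with he_def
  have hE0 : 0 ≤ configEnergy z := by unfold configEnergy; positivity
  have he0 : 0 ≤ e := by positivity
  have hfin : (collisionTimes G ε γ ∩ Icc 0 τ).Finite := hγ.locFinite 0 τ
  set bt : ℝ → ℝ := fun a => r⁻¹ * max (1 - |a| / r) 0 with hbt
  have hbt0 : ∀ a, 0 ≤ bt a ∧ bt a ≤ r⁻¹ := fun a => tent_nonneg_le hr a
  set P : ℝ → ℝ := fun s => ∑ i : Fin (N + 1), ∑ j : Fin (N + 1),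
    (if i ≠ j ∧ ‖G.sepVec (γ s i).1 (γ s j).1‖ = ε then
      bt (s - t₀) * ∫ x, cone r x x₀ * h (rhoC r (γ s) x) * cone r (γ s i).1 x *
        (LamC r δ K (γ s) x (reflectVel (G.sepVec (γ s i).1 (γ s j).1) ((γ s i).2, (γ s j).2)).1 -
          LamC r δ K (γ s) x (γ s i).2) else 0) with hP
  set Qn : ℝ → ℝ := fun s => ∑ i : Fin (N + 1), ∑ j : Fin (N + 1),
    (if i ≠ j ∧ ‖G.sepVec (γ s i).1 (γ s j).1‖ = ε then 1 + ‖(γ s i).2‖ ^ 4 + ‖(γ s j).2‖ ^ 4 else 0) with hQn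
  set J : ℝ → ℝ := fun s => FS r δ K h x₀ (Function.leftLim γ s) - FS r δ K h x₀ (γ s) with hJ
  have hQn0 : ∀ s, 0 ≤ Qn s := fun s => Finset.sum_nonneg fun i _ => Finset.sum_nonneg fun j _ => by
    split_ifs <;> positivity
  show |ε / (N + 1 : ℝ) * ∑ᶠ (s : ℝ) (_ : s ∈ collisionTimes G ε γ ∩ Icc 0 τ), P s| ≤
    ε * C1 r δ K Ch Lh τ * (1 + e) ^ 3 +
      C2 r δ K Ch * (ε / (N + 1 : ℝ) * ∑ᶠ (s : ℝ) (_ : s ∈ collisionTimes G ε γ ∩ Icc 0 τ), Qn s) / (N + 1 : ℝ)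
  rw [finsum_mem_eq_finite_toFinset_sum _ hfin, finsum_mem_eq_finite_toFinset_sum _ hfin]
  -- Step 1 at every collision time of the window
  have hstep1 : ∀ s ∈ hfin.toFinset, |P s - bt (s - t₀) * (N + 1 : ℝ) * J s| ≤
      bt (s - t₀) * (3 / (Real.pi * r ^ 3) * Ch * CR0 r δ K / 2 / ((N : ℝ) + 1)) * Qn s := fun s hs =>
    collision_step hr hδ K hhb hcont x₀ hγ hG (hfin.mem_toFinset.1 hs).1 (hbt0 (s - t₀)).1
  -- Step 2 along the window
  have hstep2 : |∑ s ∈ hfin.toFinset, bt (s - t₀) * J s| ≤ C1 r δ K Ch Lh τ * (1 + e) ^ 2 :=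
    orbit_abel_bound hτ hr hδ K hLh hhb hhL x₀ t₀ hG hγ h0 hfin
  -- Step 3: assemble
  have hsumP : ∑ s ∈ hfin.toFinset, P s = (N + 1 : ℝ) * ∑ s ∈ hfin.toFinset, bt (s - t₀) * J s +
      ∑ s ∈ hfin.toFinset, (P s - bt (s - t₀) * (N + 1 : ℝ) * J s) := by
    rw [Finset.mul_sum, ← Finset.sum_add_distrib]
    exact Finset.sum_congr rfl fun s _ => by ring
  have hR : |∑ s ∈ hfin.toFinset, (P s - bt (s - t₀) * (N + 1 : ℝ) * J s)| ≤
      r⁻¹ * (3 / (Real.pi * r ^ 3) * Ch * CR0 r δ K / 2 / ((N : ℝ) + 1)) * ∑ s ∈ hfin.toFinset, Qn s := by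
    rw [Finset.mul_sum]
    refine (Finset.abs_sum_le_sum_abs _ _).trans (Finset.sum_le_sum fun s hs => (hstep1 s hs).trans ?_)
    have hK : 0 ≤ 3 / (Real.pi * r ^ 3) * Ch * CR0 r δ K / 2 / ((N : ℝ) + 1) := by
      have hCh : 0 ≤ Ch := (abs_nonneg _).trans (hhb 0)
      have hCR : 0 ≤ CR0 r δ K := by
        have := (phiMax_pos hδ).le; have := (c4_pos δ).le; unfold CR0; positivity
      positivity
    exact mul_le_mul_of_nonneg_right (mul_le_mul_of_nonneg_right (hbt0 (s - t₀)).2 hK) (hQn0 s)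
  have hcancel : ε / (N + 1 : ℝ) * ((N + 1 : ℝ) * ∑ s ∈ hfin.toFinset, bt (s - t₀) * J s) =
      ε * ∑ s ∈ hfin.toFinset, bt (s - t₀) * J s := by
    field_simp
  rw [hsumP, mul_add, hcancel]
  have hQsum0 : 0 ≤ ∑ s ∈ hfin.toFinset, Qn s := Finset.sum_nonneg fun s _ => hQn0 s
  have hC10 : 0 ≤ C1 r δ K Ch Lh τ := by
    have hCh : 0 ≤ Ch := (abs_nonneg _).trans (hhb 0)
    have := (CS_pos hr hδ K).le
    unfold C1 CB CL; positivity
  calc |ε * ∑ s ∈ hfin.toFinset, bt (s - t₀) * J s +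
        ε / (N + 1 : ℝ) * ∑ s ∈ hfin.toFinset, (P s - bt (s - t₀) * (N + 1 : ℝ) * J s)|
      ≤ |ε * ∑ s ∈ hfin.toFinset, bt (s - t₀) * J s| +
        |ε / (N + 1 : ℝ) * ∑ s ∈ hfin.toFinset, (P s - bt (s - t₀) * (N + 1 : ℝ) * J s)| := abs_add_le _ _
    _ ≤ ε * (C1 r δ K Ch Lh τ * (1 + e) ^ 2) +
        ε / (N + 1 : ℝ) * (r⁻¹ * (3 / (Real.pi * r ^ 3) * Ch * CR0 r δ K / 2 / ((N : ℝ) + 1)) * ∑ s ∈ hfin.toFinset, Qn s) := by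
        rw [abs_mul, abs_mul, abs_of_pos hε, abs_of_pos (div_pos hε hN)]
        exact add_le_add (mul_le_mul_of_nonneg_left hstep2 hε.le) (mul_le_mul_of_nonneg_left hR (div_pos hε hN).le)
    _ ≤ ε * C1 r δ K Ch Lh τ * (1 + e) ^ 3 + C2 r δ K Ch * (ε / (N + 1 : ℝ) * ∑ s ∈ hfin.toFinset, Qn s) / (N + 1 : ℝ) := by
        have h1 : ε * (C1 r δ K Ch Lh τ * (1 + e) ^ 2) ≤ ε * C1 r δ K Ch Lh τ * (1 + e) ^ 3 := by
          have h3 : (1 + e) ^ 2 ≤ (1 + e) ^ 3 := by nlinarith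
          have h4 := mul_le_mul_of_nonneg_left h3 (mul_nonneg hε.le hC10)
          linarith
        have h2 : ε / (N + 1 : ℝ) * (r⁻¹ * (3 / (Real.pi * r ^ 3) * Ch * CR0 r δ K / 2 / ((N : ℝ) + 1)) *
            ∑ s ∈ hfin.toFinset, Qn s) = C2 r δ K Ch * (ε / (N + 1 : ℝ) * ∑ s ∈ hfin.toFinset, Qn s) / (N + 1 : ℝ) := by
          unfold C2
          field_simp
        linarith

/-- **Windowed entropy balance along one good orbit of the hard-sphere flow** (the registered
statement with the named objects of helpers C–F and the explicit constants). [folklore] -/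
theorem web_main {σ τ r δ K : ℝ} (hσ : 0 < σ) (hσ2 : σ < 2⁻¹) (hτ : 0 < τ) (hr : 0 < r) (hδ : 0 < δ)
    {h : ℝ → ℝ} {Ch Lh : ℝ} (hLh : 0 ≤ Lh) (hhb : ∀ a, |h a| ≤ Ch)
    (hhL : ∀ a b, |h a - h b| ≤ Lh * |a - b|) :
    ∃ C₁ C₂ : ℝ, ∀ (N : ℕ) (Φ : HardSphereFlow (Torus.geometry (Fin 3)) (hsDiameter σ N) (N + 1)),
    ∀ z ∈ Φ.good, ∀ (t₀ : ℝ) (x₀ : T3),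
    |hsDiameter σ N / (N + 1 : ℝ) * ∑ᶠ (s : ℝ) (_ : s ∈ collisionTimes (Torus.geometry (Fin 3)) (hsDiameter σ N)
        (fun s => Φ.flow s z) ∩ Set.Icc 0 τ),
        ∑ i : Fin (N + 1), ∑ j : Fin (N + 1),
          (if i ≠ j ∧ ‖(Torus.geometry (Fin 3)).sepVec (Φ.flow s z i).1 (Φ.flow s z j).1‖ = hsDiameter σ N then
            r⁻¹ * max (1 - |s - t₀| / r) 0 * ∫ x, cone r x x₀ * h (rhoC r (Φ.flow s z) x) * cone r (Φ.flow s z i).1 x *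
              (LamC r δ K (Φ.flow s z) x (reflectVel ((Torus.geometry (Fin 3)).sepVec (Φ.flow s z i).1
                (Φ.flow s z j).1) ((Φ.flow s z i).2, (Φ.flow s z j).2)).1 - LamC r δ K (Φ.flow s z) x (Φ.flow s z i).2)
          else 0)|
      ≤ hsDiameter σ N * C₁ * (1 + configEnergy z / (N + 1 : ℝ)) ^ 3 +
        C₂ * (hsDiameter σ N / (N + 1 : ℝ) * ∑ᶠ (s : ℝ) (_ : s ∈ collisionTimes (Torus.geometry (Fin 3))
          (hsDiameter σ N) (fun s => Φ.flow s z) ∩ Set.Icc 0 τ),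
        ∑ i : Fin (N + 1), ∑ j : Fin (N + 1),
          (if i ≠ j ∧ ‖(Torus.geometry (Fin 3)).sepVec (Φ.flow s z i).1 (Φ.flow s z j).1‖ = hsDiameter σ N then
            1 + ‖(Φ.flow s z i).2‖ ^ 4 + ‖(Φ.flow s z j).2‖ ^ 4 else 0)) / (N + 1 : ℝ) :=
  ⟨C1 r δ K Ch Lh τ, C2 r δ K Ch, fun N Φ z hz t₀ x₀ =>
    web_traj hτ hr hδ K hLh hhb hhL x₀ t₀ (hsDiameter_pos hσ N)
      (Torus.isHardSphereRegular_geometry ((hsDiameter_le hσ.le N).trans_lt hσ2)) (Φ.isTrajectory z hz)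
      (Φ.flow_zero z hz)⟩

/-- Registered stub `stub_windowedEntropyBalance` of the line `empirical-h-theorem` (crux stmt-AtomisticToContinuum-15141): body VERBATIM the skeleton def `WindowedEntropyBalance`: along every good orbit and every window the tent×cone windowed, normalised collision functional of the entropic mark `Λ̃_x(vᵢ⁻) − Λ̃_x(vᵢ⁺)` is `≤ ε·C₁(1+E/(N+1))³ + C₂·Q⁴/(N+1)` (deterministic: exact first-order jump identity of the bounded coarse-grained entropy functional, Abel summation against the tent). [folklore] -/
theorem stub_windowedEntropyBalance :
    ∀ (σ : ℝ), 0 < σ → σ < 2⁻¹ → ∀ (τ r δ K : ℝ), 0 < τ → 0 < r → 0 < δ →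
      ∀ (h : ℝ → ℝ) (Ch Lh : ℝ), 0 ≤ Ch → 0 ≤ Lh → (∀ a, |h a| ≤ Ch) → (∀ a b, |h a - h b| ≤ Lh * |a - b|) →
      ∃ C₁ C₂ : ℝ, ∀ (N : ℕ) (Φ : HardSphereFlow (Torus.geometry (Fin 3)) (hsDiameter σ N) (N + 1)),
      ∀ z ∈ Φ.good, ∀ (t₀ : ℝ) (x₀ : T3),
      let ε := hsDiameter σ N
      let Gm : Geometry (Fin 3) T3 := Torus.geometry (Fin 3)
      let γ : ℝ → Config (N + 1) (Fin 3) T3 := fun s => Φ.flow s z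
      let bx : T3 → T3 → ℝ := fun y x => 3 / (Real.pi * r ^ 3) * max (1 - Torus.euclidDist y x / r) 0
      let bt : ℝ → ℝ := fun a => r⁻¹ * max (1 - |a| / r) 0
      let ρm : Config (N + 1) (Fin 3) T3 → T3 → ℝ := fun w x => ∫ q, bx q.1 x ∂(empiricalMeasure w)
      let φδ : V3 → ℝ := fun v => localMaxwellian 1 (δ ^ 2) 0 v
      let y₀ : V3 → ℝ := fun v => Real.exp (-K) * ((1 + ‖v‖ ^ 2) ^ 2)⁻¹
      let ℓK : V3 → ℝ → ℝ := fun v y => if y₀ v ≤ y then Real.log y else Real.log (y₀ v) + (y - y₀ v) / y₀ v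
      let g : Config (N + 1) (Fin 3) T3 → T3 → V3 → ℝ := fun w x v =>
        ∫ q, bx q.1 x * φδ (v - q.2) ∂(empiricalMeasure w)
      let Λt : Config (N + 1) (Fin 3) T3 → T3 → V3 → ℝ := fun w x v => ∫ u, φδ (v - u) * ℓK u (g w x u)
      let pv : ℝ → Fin (N + 1) → Fin (N + 1) → V3 × V3 := fun s i j =>
        reflectVel (Gm.sepVec (γ s i).1 (γ s j).1) ((γ s i).2, (γ s j).2)
      let Kent : ℝ := ε / (N + 1 : ℝ) * ∑ᶠ (s : ℝ) (_ : s ∈ collisionTimes Gm ε γ ∩ Set.Icc 0 τ),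
          ∑ i : Fin (N + 1), ∑ j : Fin (N + 1),
            (if i ≠ j ∧ ‖Gm.sepVec (γ s i).1 (γ s j).1‖ = ε then
              bt (s - t₀) * ∫ x, bx x x₀ * h (ρm (γ s) x) * bx (γ s i).1 x *
                (Λt (γ s) x (pv s i j).1 - Λt (γ s) x (γ s i).2) else 0)
      let Q4 : ℝ := ε / (N + 1 : ℝ) * ∑ᶠ (s : ℝ) (_ : s ∈ collisionTimes Gm ε γ ∩ Set.Icc 0 τ),
          ∑ i : Fin (N + 1), ∑ j : Fin (N + 1),
            (if i ≠ j ∧ ‖Gm.sepVec (γ s i).1 (γ s j).1‖ = ε then 1 + ‖(γ s i).2‖ ^ 4 + ‖(γ s j).2‖ ^ 4 else 0)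
      |Kent| ≤ ε * C₁ * (1 + configEnergy z / (N + 1 : ℝ)) ^ 3 + C₂ * Q4 / (N + 1 : ℝ) := by
  intro σ hσ hσ2 τ r δ K hτ hr hδ h Ch Lh _ hLh hhb hhL
  obtain ⟨C₁, C₂, H⟩ := web_main (K := K) hσ hσ2 hτ hr hδ hLh hhb hhL
  refine ⟨C₁, C₂, fun N Φ z hz t₀ x₀ => ?_⟩
  intro ε Gm γ bx bt ρm φδ y₀ ℓK g Λt pv Kent Q4
  exact H N Φ z hz t₀ x₀

end Summit.AtomisticToContinuum.HydrodynamicLimit.Theorems.ChaosClosesEulerEntropyBalance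

end
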